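import Literature.Geometry.Riemannian.GurskyViaclovskyBackgroundNaturality
import HarnessLib

/-!
# Gursky–Viaclovsky closedness: the background equation in a chart

Support file (everything PROVED; the `def`s are explicit coordinate expressions with bodies, no
named fact) for the named fact
`Literature.Geometry.Riemannian.gurskyViaclovsky_pathClosed_weighted_four`. The Evans–Krylov and
Schauder estimates behind Gursky–Viaclovsky's Prop. 6 are statements about an equation
`F(x, u, Du, D²u) = 0` on an open subset of `ℝ⁴`. This file writes the background form of the
weighted `σ₂` path equation, `backgroundPathOperator g t (−u) = q e^{4u}` (the form used in the
fact's reductions), as such an equation for the chart representative `U = u ∘ (chartAt c)⁻¹`,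
with an EXPLICIT operator built from the metric coefficients:

* `coordHess G y p r = r − p ∘ Γ_y` — the coordinate Hessian of a `2`-jet (`= hessAt` on the jet
  of a function);
* `gvForm G t y p r` — Gursky–Viaclovsky's `A^t_u = A^t_g + ∇²u + ((1−t)/2)(Δu)g + du ⊗ du −
  ((2−t)/2)|∇u|²g`, `A^t_g = ½(Ric − (t/6)R g)` (§1, (change1)), as a bilinear form of the jet
  `(p, r)` with coefficients `G(y), Ric(G)(y), R(G)(y), Γ(G)(y), G(y)⁻¹`;
* `chartOperator G t W y p r = 2((tr_G 𝒜)² − |𝒜|²_G) − ¼W = 4σ₂(G⁻¹𝒜) − ¼W`;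
* `backgroundPathOperator_eq_chartOperator` — on an open set `U ⊆ ℝ⁴` with metric `g` of
  components `G`: `backgroundPathOperator g t (−f) y = chartOperator G t (|W_g|²(y)) y (DF(y)) (D²F(y))`
  for `f` with representative `F` (orthonormal frame at `y`, the frame identities of the
  Ellipticity file — `𝒫_t = 4σ₂(B)` with `B` the frame array of `gvForm` — and the chart
  dictionary `ChartMetricCoord`: `hessian_eq_hessAt`, `ricci_eq_ricAt`, `trace_eq_mtrAt`,
  `normSq_eq_normSqAt`, `sharp_eq_sharpAt`);
* `backgroundPathOperator_chart_eq_chartOperator` — the same read through the preferred chart at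
  a point `c` of a closed `4`-manifold: with `Φ = (chartAt c)⁻¹`, `G_c` the components of `Φ^*g`,
  `backgroundPathOperator g t (−u) (Φ y) = chartOperator G_c t (|W|²(Φ y)) y (DU(y)) (D²U(y))`
  (`backgroundPathOperator_comap`). So the solutions `u_k` of the fact's hypothesis satisfy, in
  every chart, `chartOperator G_c s_k W y (DU_k) (D²U_k) − q(Φ y)e^{4U_k} = 0` — the equation to
  which Gilbarg–Trudinger's Thm. 17.14 / Lemma 17.16 are to be applied (its uniform ellipticity
  along the solutions is `uniformlyElliptic_along_solution` of the Ellipticity file, read through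
  the frame; its concavity is that of `σ₂^{1/2}` on `Γ₂⁺`, `concave_sqrt_sigma2`).

## References

* M. J. Gursky, J. A. Viaclovsky, J. Differential Geom. 63 (2003) 131–154, §1 (change1)–(PDE),
  Prop. 6. [GurskyViaclovsky2003]
* B. O'Neill, *Semi-Riemannian Geometry* (1983), Ch. 3, Lemma 49, Def. 53. [ONeill1983]
-/

noncomputable section

open scoped Manifold ContDiff Topology
open Set Function Module Finset

namespace Literature.Geometry.Riemannian.GurskyViaclovskyPath

open Literature.Geometry.Lorentzian (PseudoRiemannianMetric)
open Literature.Geometry.Lorentzian.PseudoRiemannianMetric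
open Literature.Geometry.Lorentzian
open Literature.Geometry.Riemannian.GurskyViaclovsky

/-! ### The coordinate operator -/

section Coord

variable {E : Type*} [NormedAddCommGroup E] [NormedSpace ℝ E] [FiniteDimensional ℝ E]
  (G : E → E →L[ℝ] E →L[ℝ] ℝ)

/-- **The coordinate Hessian of a `2`-jet**: `(p, r) ↦ r − p ∘ Γ_y`, `H_{ij} = r_{ij} − Γ^k_{ij} p_k`
(O'Neill 1983, Lemma 3.49; `MetricCoord.hessAt` on the jet of a function).
[cite: ONeill1983, Ch. 3, Lemma 3.49] -/
def coordHess (y : E) (p : E →L[ℝ] ℝ) (r : E →L[ℝ] E →L[ℝ] ℝ) : E →L[ℝ] E →L[ℝ] ℝ :=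
  r - (ContinuousLinearMap.compL ℝ E E ℝ p).comp (MetricCoord.chrAt G y)

omit [FiniteDimensional ℝ E] in
/-- Unfolding lemma. [cite: ONeill1983, Ch. 3, Lemma 3.49] -/
@[simp]
theorem coordHess_apply (y : E) (p : E →L[ℝ] ℝ) (r : E →L[ℝ] E →L[ℝ] ℝ) (v w : E) :
    coordHess G y p r v w = r v w - p (MetricCoord.chrAt G y v w) := by
  simp [coordHess]

omit [FiniteDimensional ℝ E] in
/-- On the jet of a function the coordinate Hessian is `hessAt`. [cite: ONeill1983, Ch. 3, Lemma 3.49] -/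
theorem coordHess_jet (F : E → ℝ) (y : E) :
    coordHess G y (fderiv ℝ F y) (fderiv ℝ (fderiv ℝ F) y) = MetricCoord.hessAt G F y := rfl

/-- **Gursky–Viaclovsky's tensor `A^t_u` as a bilinear form of the `2`-jet** (`u`-variables):
`𝒜 = ½(Ric − (t/6)R G) + H + ((1−t)/2)(tr_G H) G + p ⊗ p − ((2−t)/2) p(♯p) G`, `H = coordHess`.
[cite: GurskyViaclovsky2003, §1 (change1)] -/
def gvForm (t : ℝ) (y : E) (p : E →L[ℝ] ℝ) (r : E →L[ℝ] E →L[ℝ] ℝ) : E →L[ℝ] E →L[ℝ] ℝ :=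
  (1 / 2 : ℝ) • (MetricCoord.ricAt G y - (t / 6 * MetricCoord.scalAt G y) • G y)
    + coordHess G y p r
    + ((1 - t) / 2 * MetricCoord.mtrAt G y (coordHess G y p r)) • G y
    + p.smulRight p
    - ((2 - t) / 2 * p (MetricCoord.sharpAt G y p)) • G y

/-- Unfolding lemma. [cite: GurskyViaclovsky2003, §1 (change1)] -/
theorem gvForm_apply (t : ℝ) (y : E) (p : E →L[ℝ] ℝ) (r : E →L[ℝ] E →L[ℝ] ℝ) (v w : E) :
    gvForm G t y p r v w =
      1 / 2 * (MetricCoord.ricAt G y v w - t / 6 * MetricCoord.scalAt G y * G y v w)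
        + coordHess G y p r v w
        + (1 - t) / 2 * MetricCoord.mtrAt G y (coordHess G y p r) * G y v w
        + p v * p w
        - (2 - t) / 2 * p (MetricCoord.sharpAt G y p) * G y v w := by
  have h : gvForm G t y p r v w =
      (1 / 2 : ℝ) * (MetricCoord.ricAt G y v w - (t / 6 * MetricCoord.scalAt G y) * G y v w)
        + coordHess G y p r v w
        + ((1 - t) / 2 * MetricCoord.mtrAt G y (coordHess G y p r)) * G y v w
        + p v * p w
        - ((2 - t) / 2 * p (MetricCoord.sharpAt G y p)) * G y v w := rfl
  exact h.trans (by ring)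

/-- **The chart operator** `4σ₂(G⁻¹𝒜) − ¼W = 2((tr_G 𝒜)² − |𝒜|²_G) − ¼W` (`σ₂` of the
endomorphism `G⁻¹𝒜` through the metric trace and square norm of the components).
[cite: GurskyViaclovsky2003, §1 (PDE)] -/
def chartOperator (t W : ℝ) (y : E) (p : E →L[ℝ] ℝ) (r : E →L[ℝ] E →L[ℝ] ℝ) : ℝ :=
  2 * (MetricCoord.mtrAt G y (gvForm G t y p r) ^ 2 - MetricCoord.normSqAt G y (gvForm G t y p r))
    - 1 / 4 * W

/-- A continuous bilinear map as a bilinear form. [folklore] -/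
def toBilin (β : E →L[ℝ] E →L[ℝ] ℝ) : LinearMap.BilinForm ℝ E :=
  (ContinuousLinearMap.coeLM ℝ).comp β.toLinearMap

omit [FiniteDimensional ℝ E] in
/-- Unfolding lemma. [folklore] -/
@[simp]
theorem toBilin_apply (β : E →L[ℝ] E →L[ℝ] ℝ) (v w : E) : toBilin β v w = β v w := rfl

end Coord

/-! ### The background operator on an open subset of `ℝ⁴` is the chart operator -/

section OpensChart

variable {U : TopologicalSpace.Opens (EuclideanSpace ℝ (Fin 4))}
  (g : PseudoRiemannianMetric 𝓘(ℝ, EuclideanSpace ℝ (Fin 4)) ∞ (EuclideanSpace ℝ (Fin 4))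
    (TangentSpace 𝓘(ℝ, EuclideanSpace ℝ (Fin 4)) : U → Type _))
  [g.HasLeviCivita]
  {G : EuclideanSpace ℝ (Fin 4) →
    EuclideanSpace ℝ (Fin 4) →L[ℝ] EuclideanSpace ℝ (Fin 4) →L[ℝ] ℝ}
  (hG : ∀ y : U, g.val y = G y)

include hG in
/-- **The background operator is the chart operator of the `2`-jet of the representative.** On an
open set `U ⊆ ℝ⁴` carrying a Riemannian metric `g` with components `G`, for `f : U → ℝ` smooth with
representative `F` (`f = F` on `U`):
`backgroundPathOperator g t (−f) y = chartOperator G t (|W_g|²(y)) y (DF(y)) (D²F(y))`.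
[cite: GurskyViaclovsky2003, §1 (change1)–(PDE)] -/
theorem backgroundPathOperator_eq_chartOperator (hg : g.IsRiemannian) (t : ℝ) {f : U → ℝ}
    (hf : ContMDiff 𝓘(ℝ, EuclideanSpace ℝ (Fin 4)) 𝓘(ℝ) ∞ f) {F : EuclideanSpace ℝ (Fin 4) → ℝ}
    (hfF : ∀ y : U, f y = F y) (y : U) (hF : ContDiffAt ℝ 2 F y) :
    backgroundPathOperator g t (fun z ↦ -f z) y =
      chartOperator G t (g.weylNormSq y) y (fderiv ℝ F y) (fderiv ℝ (fderiv ℝ F) y) := by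
  classical
  have hE : finrank ℝ (EuclideanSpace ℝ (Fin 4)) = 4 := finrank_euclideanSpace_fin
  have hn : (2 : ℕ∞ω) ≤ ((⊤ : ℕ∞) : ℕ∞ω) := WithTop.coe_le_coe.mpr le_top
  obtain ⟨b, hb⟩ := g.exists_basis_isOrthonormalFrame (x := y) (fun v hv ↦ hg y v hv) hE
  -- the `w = -f` jet in the frame
  set w : U → ℝ := fun z ↦ -f z with hw_def
  have hw : ContMDiff 𝓘(ℝ, EuclideanSpace ℝ (Fin 4)) 𝓘(ℝ) ∞ w := hf.neg
  set R := g.scalarCurvature y with hR_def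
  set Rc : Fin 4 → Fin 4 → ℝ := fun a c ↦ g.ricci y (b a) (b c) with hRc_def
  set Hw : Fin 4 → Fin 4 → ℝ := fun a c ↦ g.hessian w y (b a) (b c) with hHw_def
  set bw : Fin 4 → ℝ := fun a ↦ mvfderiv 𝓘(ℝ, EuclideanSpace ℝ (Fin 4)) w y (b a) with hbw_def
  have hRc : ∀ a c, Rc a c = Rc c a := fun a c ↦ (g.ricci_symm_holds hn y).eq (b a) (b c)
  have hw2 : ContMDiffAt 𝓘(ℝ, EuclideanSpace ℝ (Fin 4)) 𝓘(ℝ) 2 w y := (hw.of_le hn) y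
  have hH : ∀ a c, Hw a c = Hw c a := fun a c ↦ (g.hessian_symm_holds hw2).eq (b a) (b c)
  have hRsum : ∑ a, Rc a a = R := hb.sum_ricci_eq_scalarCurvature g hE
  -- left-hand side: `4σ₂(B) − ¼|W|²` for the frame array `B = gvMatrix`
  have hL : backgroundPathOperator g t w y =
      4 * sigma2 (gvMatrix t R Rc Hw bw) - g.weylNormSq y / 4 := by
    rw [backgroundPathOperator_eq_framePoly g hw t hb, sigma2WeylSchouten_eq_sigma2_frame g hg hb,
      framePoly_eq_sigma2_gvMatrix t (g.weylNormSq y) hRc hH hRsum bw]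
  -- the dictionary at `y`
  have hf2 : ContMDiffAt 𝓘(ℝ, EuclideanSpace ℝ (Fin 4)) 𝓘(ℝ) 2 f y := (hf.of_le hn) y
  have hGy : ∀ v w', G y v w' = g.val y v w' := fun v w' ↦
    (congrArg (fun B : EuclideanSpace ℝ (Fin 4) →L[ℝ] EuclideanSpace ℝ (Fin 4) →L[ℝ] ℝ ↦ B v w')
      (hG y)).symm
  have hδ : ∀ a c, G y (b a) (b c) = frameDelta a c := fun a c ↦ by
    rw [hGy]
    unfold frameDelta
    split_ifs with hac
    · subst hac; exact hb.1 a
    · exact hb.2 a c hac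
  have hric : ∀ a c, MetricCoord.ricAt G y (b a) (b c) = Rc a c := fun a c ↦
    (OpensChart.ricci_eq_ricAt hG y (b a) (b c)).symm
  have hscal : MetricCoord.scalAt G y = R := (OpensChart.scalarCurvature_eq_scalAt hG y).symm
  have hHess : ∀ a c, coordHess G y (fderiv ℝ F y) (fderiv ℝ (fderiv ℝ F) y) (b a) (b c) =
      -Hw a c := fun a c ↦ by
    rw [coordHess_jet, ← OpensChart.hessian_eq_hessAt hG y hfF hF (b a) (b c), hHw_def]
    change _ = -(g.hessian (-f) y (b a) (b c))
    rw [g.hessian_neg f y]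
    simp
  have hmtr : MetricCoord.mtrAt G y (coordHess G y (fderiv ℝ F y) (fderiv ℝ (fderiv ℝ F) y)) =
      -∑ a, Hw a a := by
    rw [coordHess_jet]
    change MetricCoord.lapAt G F y = _
    rw [← OpensChart.dalembertian_eq_lapAt hG y hfF hF, dalembertian_eq_sum_orthonormalFrame g f hb]
    have h : ∀ a, g.hessian f y (b a) (b a) = -Hw a a := fun a ↦ by
      rw [hHw_def]
      change _ = -(g.hessian (-f) y (b a) (b a))
      rw [g.hessian_neg f y]
      simp
    simp only [h, Finset.sum_neg_distrib]
  have hp : ∀ a, fderiv ℝ F y (b a) = -bw a := fun a ↦ by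
    rw [hbw_def]
    change _ = -(mvfderiv 𝓘(ℝ, EuclideanSpace ℝ (Fin 4)) (-f) y (b a))
    rw [mvfderiv_neg, ← OpensChart.mvfderiv_eq y f F hfF (hF.differentiableAt (by norm_num))]
    simp
  have hmv : mvfderiv 𝓘(ℝ, EuclideanSpace ℝ (Fin 4)) f y = fderiv ℝ F y :=
    ContinuousLinearMap.ext (OpensChart.mvfderiv_eq y f F hfF (hF.differentiableAt (by norm_num)))
  have hgrad : fderiv ℝ F y (MetricCoord.sharpAt G y (fderiv ℝ F y)) = ∑ a, bw a ^ 2 := by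
    have h1 : g.gradSq f y = ∑ a, bw a ^ 2 := by
      rw [gradSq_eq_sum_orthonormalFrame g f hb]
      refine Finset.sum_congr rfl fun a _ ↦ ?_
      rw [hbw_def]
      change _ = (mvfderiv 𝓘(ℝ, EuclideanSpace ℝ (Fin 4)) (-f) y (b a)) ^ 2
      rw [mvfderiv_neg]
      simp
    rw [← h1, PseudoRiemannianMetric.gradSq_eq, ← OpensChart.sharp_eq_sharpAt hG y, ← hmv]
    rfl
  -- the frame array of `gvForm` is `gvMatrix`
  set 𝒜 := gvForm G t y (fderiv ℝ F y) (fderiv ℝ (fderiv ℝ F) y) with h𝒜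
  have hM : ∀ a c, 𝒜 (b a) (b c) = gvMatrix t R Rc Hw bw a c := by
    intro a c
    rw [h𝒜, gvForm_apply, hric, hscal, hδ, hHess, hmtr, hp, hp, hgrad, gvMatrix]
    ring
  -- metric trace and square norm of `𝒜` in the frame
  have hO : (g.toBilinForm y).IsOrthoᵢ b := fun i j hij ↦ hb.2 i j hij
  have hcne : ∀ i, g.val y (b i) (b i) ≠ 0 := fun i ↦ by rw [hb.1 i]; exact one_ne_zero
  have htr : MetricCoord.mtrAt G y 𝒜 = ∑ a, gvMatrix t R Rc Hw bw a a := by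
    rw [← OpensChart.trace_eq_mtrAt hG y (toBilin 𝒜) 𝒜 (fun v w' ↦ rfl),
      g.trace_eq_sum_of_isOrthonormalFrame b hb]
    exact Finset.sum_congr rfl fun a _ ↦ hM a a
  have hns : MetricCoord.normSqAt G y 𝒜 = frameNormSq (gvMatrix t R Rc Hw bw) := by
    rw [← OpensChart.normSq_eq_normSqAt hG y (toBilin 𝒜) 𝒜 (fun v w' ↦ rfl),
      g.normSq_eq_sum_sq y b hO hcne, frameNormSq, Finset.sum_comm]
    refine Finset.sum_congr rfl fun a _ ↦ Finset.sum_congr rfl fun c _ ↦ ?_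
    rw [hb.1 a, hb.1 c, mul_one, div_one]
    show 𝒜 (b a) (b c) ^ 2 = _
    rw [hM a c]
  -- assemble
  rw [hL, chartOperator, ← h𝒜, htr, hns,
    sigma2_eq (gvMatrix_symm hRc hH bw), sigma1]
  ring

end OpensChart

/-! ### Through the preferred chart of a closed manifold -/

section ManifoldChart

variable {M : Type*} [TopologicalSpace M] [ChartedSpace (EuclideanSpace ℝ (Fin 4)) M]
  [IsManifold (𝓡 4) ∞ M]
  (g : PseudoRiemannianMetric (𝓡 4) ∞ (EuclideanSpace ℝ (Fin 4)) (TangentSpace (𝓡 4) : M → Type _))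
  [g.HasLeviCivita]

/-- **The background equation in the preferred chart at `c`.** Let `Φ = (chartAt c)⁻¹` on
`U = (chartAt c).target`, `G_c` the components of `Φ^*g` (the representative of its value, as in
the chart-transport lemmas), `u : M → ℝ` smooth and `U = u ∘ Φ`. Then for `y ∈ U`,
`backgroundPathOperator g t (−u) (Φ y) = chartOperator G_c t (|W_g|²(Φ y)) y (DU(y)) (D²U(y))`
(`backgroundPathOperator_comap` + `backgroundPathOperator_eq_chartOperator` + `weylNormSq_comap`).
Consequently a solution of `backgroundPathOperator g t (−u) = q e^{4u}` solves, in the chart, the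
second-order equation `chartOperator G_c t (|W|² ∘ Φ) y (DU) (D²U) − (q ∘ Φ) e^{4U} = 0`.
[cite: GurskyViaclovsky2003, §1 (change1)–(PDE) and Prop. 6] -/
theorem backgroundPathOperator_chart_eq_chartOperator (hg : g.IsRiemannian) (t : ℝ) {u : M → ℝ}
    (hu : ContMDiff (𝓡 4) 𝓘(ℝ) ∞ u) (c : M) {y : EuclideanSpace ℝ (Fin 4)}
    (hy : y ∈ (chartAt (EuclideanSpace ℝ (Fin 4)) c).target) :
    let U : TopologicalSpace.Opens (EuclideanSpace ℝ (Fin 4)) :=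
      ⟨(chartAt (EuclideanSpace ℝ (Fin 4)) c).target,
        (chartAt (EuclideanSpace ℝ (Fin 4)) c).open_target⟩
    let Φ : U → M := fun z ↦ (chartAt (EuclideanSpace ℝ (Fin 4)) c).symm z
    let gU := g.comap (contMDiff_pullbackBilin_holds) Φ (ChartInverseSelf.contMDiff_symm c)
      (ChartInverseSelf.injective_mfderiv_symm c) rfl
    backgroundPathOperator g t (fun m ↦ -u m) ((chartAt (EuclideanSpace ℝ (Fin 4)) c).symm y) =
      chartOperator
        (Function.extend (Subtype.val : U → EuclideanSpace ℝ (Fin 4))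
          (fun z : U ↦ (gU.val z :
            EuclideanSpace ℝ (Fin 4) →L[ℝ] EuclideanSpace ℝ (Fin 4) →L[ℝ] ℝ)) (fun _ ↦ 0))
        t (g.weylNormSq ((chartAt (EuclideanSpace ℝ (Fin 4)) c).symm y)) y
        (fderiv ℝ (fun z ↦ u ((chartAt (EuclideanSpace ℝ (Fin 4)) c).symm z)) y)
        (fderiv ℝ (fderiv ℝ (fun z ↦ u ((chartAt (EuclideanSpace ℝ (Fin 4)) c).symm z))) y) := by
  intro U Φ gU
  haveI : gU.HasLeviCivita := gU.hasLeviCivita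
  set G : EuclideanSpace ℝ (Fin 4) →
      EuclideanSpace ℝ (Fin 4) →L[ℝ] EuclideanSpace ℝ (Fin 4) →L[ℝ] ℝ :=
    Function.extend (Subtype.val : U → EuclideanSpace ℝ (Fin 4))
      (fun z : U ↦ (gU.val z :
        EuclideanSpace ℝ (Fin 4) →L[ℝ] EuclideanSpace ℝ (Fin 4) →L[ℝ] ℝ)) (fun _ ↦ 0) with hGdef
  have hG : ∀ z : U, gU.val z = G z := fun z ↦ by
    rw [hGdef, Subtype.val_injective.extend_apply]
  have hgU : gU.IsRiemannian := fun z v hv ↦ by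
    have h1 : gU.val z v v = g.val (Φ z)
        (mfderiv 𝓘(ℝ, EuclideanSpace ℝ (Fin 4)) 𝓘(ℝ, EuclideanSpace ℝ (Fin 4)) Φ z v)
        (mfderiv 𝓘(ℝ, EuclideanSpace ℝ (Fin 4)) 𝓘(ℝ, EuclideanSpace ℝ (Fin 4)) Φ z v) := rfl
    rw [h1]
    exact hg _ _ fun h0 ↦ hv ((ChartInverseSelf.injective_mfderiv_symm c z) (by
      rw [h0]
      exact ((mfderiv 𝓘(ℝ, EuclideanSpace ℝ (Fin 4)) 𝓘(ℝ, EuclideanSpace ℝ (Fin 4)) Φ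
        z).map_zero).symm))
  set y' : U := ⟨y, hy⟩ with hy'
  -- naturality: the background operator of `Φ^*g` and `(-u) ∘ Φ` at `y'`
  have hnat := backgroundPathOperator_comap g (contMDiff_pullbackBilin_holds)
    (ChartInverseSelf.contMDiff_symm c) (ChartInverseSelf.injective_mfderiv_symm c) rfl hg
    (w := fun m ↦ -u m) hu.neg t y'
  have hW := g.weylNormSq_comap (contMDiff_pullbackBilin_holds) (ChartInverseSelf.contMDiff_symm c)
    (ChartInverseSelf.injective_mfderiv_symm c) rfl hg y'
  -- the chart operator for `f = u ∘ Φ` on `U`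
  have hf : ContMDiff 𝓘(ℝ, EuclideanSpace ℝ (Fin 4)) 𝓘(ℝ) ∞ (u ∘ Φ) :=
    hu.comp ((ChartInverseSelf.contMDiff_symm c).of_le le_self_add)
  have hF : ContDiffAt ℝ 2 (fun z ↦ u ((chartAt (EuclideanSpace ℝ (Fin 4)) c).symm z)) y :=
    (ChartInverseSelf.contDiffAt_comp_symm c hu hy).of_le (WithTop.coe_le_coe.mpr le_top)
  have hchart := backgroundPathOperator_eq_chartOperator gU hG hgU t hf
    (F := fun z ↦ u ((chartAt (EuclideanSpace ℝ (Fin 4)) c).symm z)) (fun z ↦ rfl) y' hF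
  have hcomp : (fun z : U ↦ -(u ∘ Φ) z) = (fun m ↦ -u m) ∘ Φ := rfl
  rw [hcomp, hnat, hW] at hchart
  exact hchart

end ManifoldChart

end Literature.Geometry.Riemannian.GurskyViaclovskyPath

end
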